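import Literature.AlgebraicGeometry.AbelianSchemes.BanalBlockFrobeniusKernelLaw      -- ★ LA4-p04 §1 «killed by an ideal» calculus, ★ (FK0), ★ `RingAction.i_natCast`
import Literature.AlgebraicGeometry.AbelianSchemes.DualIsogenyDegree                 -- ★ `homOfIsMonHom`, ★ `mulN_eq_hom_zsmul_id`
import Literature.AlgebraicGeometry.Motives.AbelianVarietyKernelLawBlockAssembly     -- ★ (E2-asm) `comp_relFrobenius_eq_one_iff_of_blocks`
import Literature.AlgebraicGeometry.Motives.AbelianVarietyTangentKillers             -- ★ `comp_hom_hom_hom_sum`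
import HarnessLib

/-!
# The Frobenius-kernel law «`t ≫ F_q = 1 ↔ ∀ a ∈ 𝔠, t ≫ ι(a) ≫ q̄ = 1`» ON ALL `T`-POINTS from PER-BLOCK laws on `q`-torsion points
# ([MumfordAV1970] §15 p. 146, §19; [Tate1997FiniteFlatGroupSchemes] (3.7); [Neukirch1999] I (3.6); [Liu2021] Prop. D.8 (3))

Topic `Literature/AlgebraicGeometry/AbelianSchemes`, namespace `Literature.AlgebraicGeometry.AbelianSchemes.AbelianSchemeOver`.  THEOREMS ONLY (no definition,
no instance, no notation, no named fact, no `sorry`).  Cell `hodgecm-mathlib` (D-0151), FLOOR 0, P6 «MOD programme» (crux hLiu418 = stmt-HodgeConjecture-24832,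
`--supports`, count-neutral): organ **(rL-asm) «ALL-`T` ASSEMBLY OF THE FROBENIUS-KERNEL LAW FROM PER-BLOCK LAWS»** (LA3-plan (g0) ruling 2026-09-02T02:47Z →
A-p03 (g31); consumer LA3-p01's `stub_ROOFGEO`, the (rL) conjunct of Defs `Roof₀` :542, whose text this head reproduces with `act₀Of … a x̄ ↦ act.i a`).  HC_CM is proved
only modulo the printed citations until rung 0 closes; this file is generic and changes no count.

THE MATHEMATICS.  `k` perfect of characteristic `p`, `q = p^r`, `A` an abelian scheme over `Spec k` with a ring action `ι : O → End A`, `q̄ : A → Y` a homomorphism of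
`k`-group schemes, `𝔠, 𝔭 ⊂ O` ideals with `q ∈ 𝔠𝔭` and `Ker q̄ ⊆ A[𝔭]` on `T`-points.  (§2) BOTH sides of the law force `[q] t = 1`: `t ≫ F^{(r)} = 1 ⇒ [p^r] t = 1` since
`[p^r] = V^{(r)} ∘ F^{(r)}` ([MumfordAV1970] §15 p. 146; ★ (FK0)); and `ι(𝔠) t ⊆ Ker q̄ ⊆ A[𝔭]` gives `ι(𝔠𝔭) t = 1 ∋ ι(q) t = [q] t`.  (§1, §3) For a `q`-torsion point and
elements `e_i ∈ O` with `Σ e_i ≡ 1`, `e_i² ≡ e_i (mod q)` (the CRT idempotents of `O ⁄ q`, [Neukirch1999] I (3.6)), `ι(Σ e_i) t = t` and each component `x_i = ι(e_i) t` is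
`q`-torsion and FIXED by `ι(e_i)`; `ι(𝔠)` is stable under `ι(e_i) ∘ ·`; so ★ (E2-asm) `AbelianVariety.comp_relFrobenius_eq_one_iff_of_blocks` ([MumfordAV1970] §19: a point all of
whose components lie in a subgroup lies in it) reduces the law for `t` to the law for the components — the PER-BLOCK LAWS, stated for `q`-torsion points fixed by `ι(e_i)` (the
shape of ★ P6b `WBlockLaw.rL_W'` and ★ LA4-p04 `comp_relFrobeniusOver_eq_one_iff_of_lieSignature_zero`).  (§4) BRIDGES for the block suppliers: a `q`-torsion point fixed by
`ι(e)` is killed by every `b` with `b e ∈ (q)` (so the `u`-component is `𝔭_u^{r e_u}`-primary); on points killed by an ideal `𝔟` COPRIME to `𝔭` the right-hand side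
«`ι(𝔠) x ⊆ Ker q̄`» reads «`x` is killed by `𝔞`» for any `𝔞` with `𝔠 + 𝔟 = 𝔞 + 𝔟` (`Ker q̄ ∩ A[𝔟] ⊆ A[𝔭 + 𝔟] = 1`) — the BANAL-block form, fed by ★ `FrobKernelBanal₀`-shaped laws
(`t ≫ F = 1 ↔ ι(𝔞) t = 1` on `𝔟`-torsion points) — and «`x ∈ Ker q̄`» when `𝔠 + 𝔟 = O` and `Ker q̄` is `ι`-stable (the `c•w`-block form, [Liu2021] p. 137).

* §1 `RingAction` torsion calculus (any base): `comp_i_sum`, `comp_i_eq_one_of_mem_span_of_comp_mulN`, `comp_i_eq_self_of_sub_one_mem_span`, `comp_i_comp_mulN_eq_one`,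
  `comp_i_comp_i_eq_of_mul_self_sub_mem`, **`comp_i_eq_one_of_mul_mem_span`** (fixed + torsion ⇒ killed by the annihilator of `e mod q`).
* §2 reductions (`k` perfect, `CharP k p`): **`comp_mulN_eq_one_of_comp_relFrobeniusOver_eq_one`** (★ (FK0) in `AbelianSchemeOver` tokens), `forall_comp_i_eq_one_of_mem_mul`,
  **`comp_mulN_eq_one_of_forall_comp_i_comp_eq_one`**.
* §3 HEADS: **`comp_relFrobeniusOver_eq_one_iff_of_blocks_of_comp_mulN_eq_one`** (on a `q`-torsion point) and
  **`comp_relFrobeniusOver_eq_one_iff_of_torsion_blocks`** (on ALL `T`-points; `Roof₀` (rL) token shape).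
* §4 bridges: **`forall_comp_i_comp_eq_one_iff_forall_comp_i_eq_one`** (banal form), **`blockLaw_of_idealTorsionLaw`** ((S-fixed) law from a `𝔟`-torsion law),
  **`forall_comp_i_comp_eq_one_iff_comp_eq_one`** (`c•w` form: `𝔠 + 𝔟 = O`, `Ker q̄` `ι`-stable).

## References
* [MumfordAV1970] D. Mumford, *Abelian Varieties* (1970), §15 (p. 146: `V ∘ F = [p]`), §19 (first paragraph: `Hom(X, Y)`, pointwise addition; Thm. 3 p. 176).
* [Tate1997FiniteFlatGroupSchemes] J. Tate, *Finite flat group schemes*, in: Modular Forms and Fermat's Last Theorem (1997), (3.7).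
* [Neukirch1999] J. Neukirch, *Algebraic Number Theory* (1999), Ch. I §3 (3.6) (Chinese remainder theorem).
* [Liu2021] Y. Liu, *Fourier–Jacobi cycles and arithmetic relative trace formula*, Camb. J. Math. 9 (2021), Prop. D.8 (3) p. 135, pp. 136–138.
* [GortzWedhorn2020] U. Görtz, T. Wedhorn, *Algebraic Geometry I* (2nd ed. 2020), Definition 4.45 (2) (p. 117).
-/

set_option autoImplicit false

-- Mathlib's `Over`/`Scheme` APIs are stated across semireducible wrappers (as in ★ `BanalBlockFrobeniusKernelLaw`, ★ (E2-asm)).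
set_option backward.isDefEq.respectTransparency false

noncomputable section

universe u

open CategoryTheory CategoryTheory.Limits AlgebraicGeometry MonoidalCategory CartesianMonoidalCategory
open scoped MonObj

namespace Literature.AlgebraicGeometry.AbelianSchemes.AbelianSchemeOver

open Literature.AlgebraicGeometry.Motives Literature.AlgebraicGeometry.Motives.AbelianVariety

/-! ## §1 Torsion calculus for a ring action (any base) -/

section Torsion

namespace RingAction

variable {S : Scheme.{u}} {A : AbelianSchemeOver S} {O : Type*} [CommRing O] (act : RingAction O A)

/-- **`ι(Σᵢ fᵢ)(t) = ∏ᵢ ι(fᵢ)(t)`** on `T`-points (`ι` additive: `ι(a + b) = ι(a)·ι(b)`, `ι(0) = 1`). [cite: MumfordAV1970, §19 (Hom(X,Y), first paragraph)] -/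
theorem comp_i_sum [IsCommMonObj A.X] {T : Over S} (t : T ⟶ A.X) {J : Type*} (s : Finset J) (f : J → O) :
    t ≫ act.i (∑ i ∈ s, f i) = ∏ i ∈ s, (t ≫ act.i (f i)) := by
  classical
  induction s using Finset.induction_on with
  | empty =>
    haveI := act.isMonHom_i (0 : O)
    rw [Finset.sum_empty, Finset.prod_empty, act.i_zero, MonObj.comp_one]
  | insert i s hi ih => rw [Finset.sum_insert hi, Finset.prod_insert hi, act.comp_i_add, ih]

/-- **A `[N]`-torsion point is killed by `ι((N))`**: `t ≫ [N] = 1` and `d ∈ (N)` give `t ≫ ι(d) = 1` (`ι(N) = [N]`, ★ `RingAction.i_natCast`).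
[cite: MumfordAV1970, §19 Thm. 3 (p. 176)] -/
theorem comp_i_eq_one_of_mem_span_of_comp_mulN {T : Over S} (t : T ⟶ A.X) {N : ℕ} (hN : t ≫ A.mulN N = 1)
    {d : O} (hd : d ∈ Ideal.span {(N : O)}) : t ≫ act.i d = 1 := by
  refine (act.forall_mem_span_singleton_iff t).2 ?_ d hd
  rw [RingAction.i_natCast act N, ← mulN_def]
  exact hN

/-- **A `[N]`-torsion point is FIXED by every `e ≡ 1 (mod N)`**: `t ≫ ι(e) = t`. [cite: Neukirch1999, Ch. I §3 (3.6)] -/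
theorem comp_i_eq_self_of_sub_one_mem_span {T : Over S} (t : T ⟶ A.X) {N : ℕ} (hN : t ≫ A.mulN N = 1)
    {e : O} (he : e - 1 ∈ Ideal.span {(N : O)}) : t ≫ act.i e = t :=
  act.comp_i_eq_self_of_sub_one_mem t (fun _ hb => act.comp_i_eq_one_of_mem_span_of_comp_mulN t hN hb) he

/-- **Components of a torsion point are torsion**: `(t ≫ ι(a)) ≫ [N] = 1` when `t ≫ [N] = 1` (`[N] = ι(N)` commutes with `ι(a)`).
[cite: MumfordAV1970, §19 Thm. 3 (p. 176)] -/
theorem comp_i_comp_mulN_eq_one {T : Over S} (t : T ⟶ A.X) {N : ℕ} (hN : t ≫ A.mulN N = 1) (a : O) :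
    (t ≫ act.i a) ≫ A.mulN N = 1 := by
  haveI := act.isMonHom_i a
  rw [mulN_def, ← RingAction.i_natCast act N, Category.assoc, ← act.i_mul, ← mul_comm, act.i_mul, ← Category.assoc,
    RingAction.i_natCast act N, ← mulN_def, hN, MonObj.one_comp]

/-- **Components at an idempotent are fixed**: if `e² ≡ e (mod N)` and `t ≫ [N] = 1` then `(t ≫ ι(e)) ≫ ι(e) = t ≫ ι(e)`. [cite: Neukirch1999, Ch. I §3 (3.6)]
[cite: Tate1997FiniteFlatGroupSchemes, (3.7)] -/
theorem comp_i_comp_i_eq_of_mul_self_sub_mem {T : Over S} (t : T ⟶ A.X) {N : ℕ} (hN : t ≫ A.mulN N = 1)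
    {e : O} (he : e * e - e ∈ Ideal.span {(N : O)}) : (t ≫ act.i e) ≫ act.i e = t ≫ act.i e := by
  have h1 : e * e = e + (e * e - e) := by ring
  rw [Category.assoc, ← act.i_mul, h1, act.comp_i_add, act.comp_i_eq_one_of_mem_span_of_comp_mulN t hN he, mul_one]

/-- **A `[N]`-torsion point fixed by `ι(e)` is killed by every `b` with `b·e ∈ (N)`** — so the `e_u`-component of a `q`-torsion point is `u`-PRIMARY
(killed by `𝔭_u^{r e_u}`, as `𝔭_u^{r e_u}·e_u ⊆ (p^r)`): the adapter from the (S-fixed) shape of the per-block laws to the `𝔟`-torsion shape of ★ `FrobKernelBanal₀`.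
[cite: Neukirch1999, Ch. I §3 (3.6)] [cite: Tate1997FiniteFlatGroupSchemes, (3.7)] -/
theorem comp_i_eq_one_of_mul_mem_span {T : Over S} (t : T ⟶ A.X) {N : ℕ} (hN : t ≫ A.mulN N = 1) {e : O}
    (hfix : t ≫ act.i e = t) {b : O} (hb : b * e ∈ Ideal.span {(N : O)}) : t ≫ act.i b = 1 := by
  rw [← hfix, Category.assoc, ← act.i_mul]
  exact act.comp_i_eq_one_of_mem_span_of_comp_mulN t hN hb

/-- The same for an ideal `𝔟` with `𝔟·e ⊆ (N)`: the point is killed by `𝔟`. [cite: Neukirch1999, Ch. I §3 (3.6)] -/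
theorem forall_comp_i_eq_one_of_mul_mem_span {T : Over S} (t : T ⟶ A.X) {N : ℕ} (hN : t ≫ A.mulN N = 1) {e : O}
    (hfix : t ≫ act.i e = t) {𝔟 : Ideal O} (h𝔟 : ∀ b ∈ 𝔟, b * e ∈ Ideal.span {(N : O)}) : ∀ b ∈ 𝔟, t ≫ act.i b = 1 :=
  fun _ hb => act.comp_i_eq_one_of_mul_mem_span t hN hfix (h𝔟 _ hb)

end RingAction

end Torsion

/-! ## §2 Both sides of the law force `[q] t = 1` -/

section ReductionRight

variable {S : Scheme.{u}} {A : AbelianSchemeOver S} {O : Type*} [CommRing O] (act : RingAction O A) {Y : Over S} [GrpObj Y] (qbar : A.X ⟶ Y)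

/-- **`ι(𝔠) t ⊆ Ker q̄ ⊆ A[𝔭]` ⇒ `t` is killed by `𝔠·𝔭`** (`ι(ba) = ι(a) ≫ ι(b)`; additivity over the sums generating `𝔠𝔭`). [cite: MumfordAV1970, §19 (Hom(X,Y), first paragraph)]
[cite: GortzWedhorn2020, Definition 4.45 (2) (p. 117)] -/
theorem forall_comp_i_eq_one_of_mem_mul (𝔠 𝔭 : Ideal O)
    (hker : ∀ ⦃T : Over S⦄ (z : T ⟶ A.X), z ≫ qbar = 1 → ∀ b ∈ 𝔭, z ≫ act.i b = 1)
    {T : Over S} (t : T ⟶ A.X) (h : ∀ a ∈ 𝔠, t ≫ act.i a ≫ qbar = 1) : ∀ d ∈ 𝔠 * 𝔭, t ≫ act.i d = 1 := by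
  intro d hd
  refine Submodule.mul_induction_on hd (fun a ha b hb => ?_) (fun x y hx hy => ?_)
  · rw [mul_comm, act.i_mul, ← Category.assoc]
    exact hker (t ≫ act.i a) (by rw [Category.assoc]; exact h a ha) b hb
  · rw [act.comp_i_add, hx, hy, mul_one]

/-- **The right-hand side forces `[N] t = 1`**: `∀ a ∈ 𝔠, t ≫ ι(a) ≫ q̄ = 1`, `Ker q̄ ⊆ A[𝔭]` and `N ∈ 𝔠𝔭` give `t ≫ [N] = 1`.
[cite: MumfordAV1970, §19 Thm. 3 (p. 176)] [cite: Liu2021, Prop. D.8 (3) pp. 136–138] -/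
theorem comp_mulN_eq_one_of_forall_comp_i_comp_eq_one (𝔠 𝔭 : Ideal O) {N : ℕ} (hN : (N : O) ∈ 𝔠 * 𝔭)
    (hker : ∀ ⦃T : Over S⦄ (z : T ⟶ A.X), z ≫ qbar = 1 → ∀ b ∈ 𝔭, z ≫ act.i b = 1)
    {T : Over S} (t : T ⟶ A.X) (h : ∀ a ∈ 𝔠, t ≫ act.i a ≫ qbar = 1) : t ≫ A.mulN N = 1 :=
  act.comp_mulN_eq_one_of_natCast_mem t (forall_comp_i_eq_one_of_mem_mul act qbar 𝔠 𝔭 hker t h) hN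

end ReductionRight

section ReductionLeft

variable {k : Type u} [Field k] [PerfectField k] (p : ℕ) [Fact p.Prime] [CharP k p] (r : ℕ) (A : AbelianSchemeOver (Spec (.of k)))

/-- **(FK0) in `AbelianSchemeOver` tokens: a point killed by `F^{(r)}_{A∕k}` is `[p^r]`-torsion** (`[p^r] = F^{(r)} ≫ V^{(r)}`; ★
`AbelianVariety.comp_pow_zsmul_id_eq_one_of_comp_relFrobenius_eq_one`, ★ `mulN_eq_hom_zsmul_id`). [cite: MumfordAV1970, §15 (p. 146)] -/
theorem comp_mulN_eq_one_of_comp_relFrobeniusOver_eq_one {T : SchemeOver k} (t : T ⟶ A.X)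
    (h : t ≫ relFrobeniusOver p r A.X = (1 : T ⟶ (A.baseChange (frobSpec k p r)).X)) : t ≫ A.mulN (p ^ r) = 1 := by
  have h' : t ≫ (A.toAffine.toAbelianVariety.relFrobenius p r).hom.hom.hom = 1 := h
  rw [A.mulN_eq_hom_zsmul_id (p ^ r)]
  exact A.toAffine.toAbelianVariety.comp_pow_zsmul_id_eq_one_of_comp_relFrobenius_eq_one p r t h'

end ReductionLeft

/-! ## §3 HEADS: the assembly on a `q`-torsion point, then on every point -/

section Assembly

variable {k : Type u} [Field k] [PerfectField k] (p : ℕ) [Fact p.Prime] [CharP k p] (r : ℕ)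
  (A : AbelianSchemeOver (Spec (.of k))) {O : Type*} [CommRing O] (act : RingAction O A)
  {Y : SchemeOver k} [GrpObj Y] (qbar : A.X ⟶ Y) [IsMonHom qbar] (𝔠 : Ideal O)
  {J : Type*} (s : Finset J) (e : J → O)

omit [PerfectField k] in
/-- **THE ASSEMBLY ON A `q`-TORSION POINT.**  `e_i` (`i ∈ s`) with `Σ e_i ≡ 1` and `e_i² ≡ e_i (mod q)`, `q = p^r`; PER-BLOCK LAWS: for every `q`-torsion `T`-point `x`
fixed by `ι(e_i)`, `x ≫ F^{(r)} = 1 ↔ ∀ a ∈ 𝔠, x ≫ ι(a) ≫ q̄ = 1`.  Then the law holds for every `q`-torsion point `t` (★ (E2-asm) `AbelianVariety.comp_relFrobenius_eq_one_iff_of_blocks`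
at `ε_i := ι(e_i)`, `Φ := ι(𝔠)`: `ι(Σ e_i) t = t`, `ι(e_i) ≫ ι(a) = ι(a e_i) ∈ ι(𝔠)`, components `q`-torsion and fixed).  [cite: MumfordAV1970, §19 (first paragraph)]
[cite: Neukirch1999, Ch. I §3 (3.6)] [cite: Tate1997FiniteFlatGroupSchemes, (3.7)] -/
theorem comp_relFrobeniusOver_eq_one_iff_of_blocks_of_comp_mulN_eq_one
    (hsum : (∑ i ∈ s, e i) - 1 ∈ Ideal.span {((p ^ r : ℕ) : O)})
    (hidem : ∀ i ∈ s, e i * e i - e i ∈ Ideal.span {((p ^ r : ℕ) : O)})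
    (law : ∀ i ∈ s, ∀ ⦃T : SchemeOver k⦄ (x : T ⟶ A.X), x ≫ A.mulN (p ^ r) = 1 → x ≫ act.i (e i) = x →
      (x ≫ relFrobeniusOver p r A.X = (1 : T ⟶ (A.baseChange (frobSpec k p r)).X) ↔ ∀ a ∈ 𝔠, x ≫ act.i a ≫ qbar = 1))
    {T : SchemeOver k} (t : T ⟶ A.X) (htN : t ≫ A.mulN (p ^ r) = 1) :
    t ≫ relFrobeniusOver p r A.X = (1 : T ⟶ (A.baseChange (frobSpec k p r)).X) ↔ ∀ a ∈ 𝔠, t ≫ act.i a ≫ qbar = 1 := by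
  haveI := act.isMonHom
  -- the blocks as endomorphisms of the abelian variety `A`, the ideal `ι(𝔠)` as a set of endomorphisms
  let ε : J → (A.toAffine.toAbelianVariety ⟶ A.toAffine.toAbelianVariety) := fun i => homOfIsMonHom (act.i (e i))
  let Φ : Set (A.toAffine.toAbelianVariety ⟶ A.toAffine.toAbelianVariety) := (fun a => homOfIsMonHom (act.i a)) '' (𝔠 : Set O)
  have hεhom : ∀ i, (ε i).hom.hom.hom = act.i (e i) := fun i => rfl
  -- `ι(Σ e_i) t = t`
  haveI : IsCommMonObj A.X := inferInstanceAs (IsCommMonObj A.toAffine.toAbelianVariety.X)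
  have hsum' : t ≫ (∑ i ∈ s, ε i).hom.hom.hom = t := by
    refine (comp_hom_hom_hom_sum t s ε).trans ?_
    change (∏ i ∈ s, (t ≫ act.i (e i))) = t
    rw [← act.comp_i_sum, act.comp_i_eq_self_of_sub_one_mem_span t htN hsum]
  -- `ι(𝔠)` is stable under `ι(e_i) ≫ ·`
  have hΦ : ∀ i ∈ s, ∀ φ ∈ Φ, ε i ≫ φ ∈ Φ := by
    rintro i - φ ⟨a, ha, rfl⟩
    refine ⟨a * e i, 𝔠.mul_mem_right _ ha, AbelianVariety.hom_ext _ _ ?_⟩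
    rw [homOfIsMonHom_hom, AbelianVariety.comp_hom]
    change act.i (a * e i) = act.i (e i) ≫ act.i a
    exact act.i_mul a (e i)
  -- the per-block laws on the components
  have law' : ∀ i ∈ s, ((t ≫ (ε i).hom.hom.hom) ≫ (A.toAffine.toAbelianVariety.relFrobenius p r).hom.hom.hom = 1 ↔
      ∀ φ ∈ Φ, (t ≫ (ε i).hom.hom.hom) ≫ φ.hom.hom.hom ≫ qbar = 1) := by
    intro i hi
    rw [hεhom, Set.forall_mem_image]
    exact law i hi (t ≫ act.i (e i)) (act.comp_i_comp_mulN_eq_one t htN (e i)) (act.comp_i_comp_i_eq_of_mul_self_sub_mem t htN (hidem i hi))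
  -- ★ (E2-asm)
  have key := A.toAffine.toAbelianVariety.comp_relFrobenius_eq_one_iff_of_blocks p r qbar s ε Φ t hsum' hΦ law'
  rw [Set.forall_mem_image] at key
  exact key

/-- **THE FROBENIUS-KERNEL LAW ON ALL `T`-POINTS FROM PER-BLOCK LAWS** — the (rL) conjunct of Defs `Roof₀` «`t ≫ F_q = 1 ↔ ∀ a ∈ 𝔠, t ≫ ι(a) ≫ q̄ = 1`», token shape with
`act₀Of … a x̄ ↦ act.i a`.  `k` perfect of characteristic `p`, `q = p^r`; `q̄ : A → Y` a homomorphism; `𝔠, 𝔭` with `q ∈ 𝔠𝔭` and `Ker q̄ ⊆ A[𝔭]` (`hker`); `e_i` with `Σ e_i ≡ 1`,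
`e_i² ≡ e_i (mod q)`; PER-BLOCK LAWS on `q`-torsion points fixed by `ι(e_i)`.  Both sides force `[q] t = 1` (§2), then §3's torsion assembly.  In the P6 ROOF: `e_i` = the CRT
idempotents of `𝒪_F ⁄ q` at `w`, `c•w` and the banal `u ∣ p`; `𝔠 = 𝔞_γ 𝔭_w⁻¹`, `𝔭 = 𝔭_w 𝔭_{c•w}` (`Ker q̄ = sp(H_L ⊕ H_L^⊥)`), `q = n_γ ∈ 𝔞_γ = 𝔠 𝔭_w`.
[cite: Liu2021, Prop. D.8 (3) p. 135, pp. 136–138] [cite: MumfordAV1970, §15 (p. 146), §19 (first paragraph)] [cite: Tate1997FiniteFlatGroupSchemes, (3.7)] -/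
theorem comp_relFrobeniusOver_eq_one_iff_of_torsion_blocks (𝔭 : Ideal O)
    (hq : ((p ^ r : ℕ) : O) ∈ 𝔠 * 𝔭)
    (hker : ∀ ⦃T : SchemeOver k⦄ (z : T ⟶ A.X), z ≫ qbar = 1 → ∀ b ∈ 𝔭, z ≫ act.i b = 1)
    (hsum : (∑ i ∈ s, e i) - 1 ∈ Ideal.span {((p ^ r : ℕ) : O)})
    (hidem : ∀ i ∈ s, e i * e i - e i ∈ Ideal.span {((p ^ r : ℕ) : O)})
    (law : ∀ i ∈ s, ∀ ⦃T : SchemeOver k⦄ (x : T ⟶ A.X), x ≫ A.mulN (p ^ r) = 1 → x ≫ act.i (e i) = x →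
      (x ≫ relFrobeniusOver p r A.X = (1 : T ⟶ (A.baseChange (frobSpec k p r)).X) ↔ ∀ a ∈ 𝔠, x ≫ act.i a ≫ qbar = 1))
    ⦃T : SchemeOver k⦄ (t : T ⟶ A.X) :
    t ≫ relFrobeniusOver p r A.X = (1 : T ⟶ (A.baseChange (frobSpec k p r)).X) ↔ ∀ a ∈ 𝔠, t ≫ act.i a ≫ qbar = 1 := by
  constructor
  · intro h
    exact (comp_relFrobeniusOver_eq_one_iff_of_blocks_of_comp_mulN_eq_one p r A act qbar 𝔠 s e hsum hidem law t
      (comp_mulN_eq_one_of_comp_relFrobeniusOver_eq_one p r A t h)).1 h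
  · intro h
    exact (comp_relFrobeniusOver_eq_one_iff_of_blocks_of_comp_mulN_eq_one p r A act qbar 𝔠 s e hsum hidem law t
      (comp_mulN_eq_one_of_forall_comp_i_comp_eq_one act qbar 𝔠 𝔭 hq hker t h)).2 h

end Assembly

/-! ## §4 Bridges for the block suppliers -/

section Bridges

variable {S : Scheme.{u}} {A : AbelianSchemeOver S} {O : Type*} [CommRing O] (act : RingAction O A)
  {Y : Over S} [GrpObj Y] (qbar : A.X ⟶ Y) [IsMonHom qbar]

/-- **BANAL FORM OF THE RIGHT-HAND SIDE.**  On a point `x` killed by an ideal `𝔟` COPRIME to `𝔭`, with `Ker q̄ ⊆ A[𝔭]` and `𝔠 + 𝔟 = 𝔞 + 𝔟`: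
«`∀ a ∈ 𝔠, x ≫ ι(a) ≫ q̄ = 1`» ↔ «`∀ a ∈ 𝔞, x ≫ ι(a) = 1`» (the points `ι(a) x` are `𝔟`-torsion, and `Ker q̄ ∩ A[𝔟] ⊆ A[𝔭 + 𝔟] = A[O] = 1`; ★ LA4-p04 §1
`forall_mem_sup_iff`, `forall_mem_top_iff`).  In the P6 ROOF: `𝔟 = 𝔭_u^n` for a banal `u`, `𝔞 = 𝔞_γ`, `𝔠 = 𝔞_γ 𝔭_w⁻¹` (same `u`-part). [cite: Liu2021, Prop. D.8 (3) pp. 136–138]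
[cite: Tate1997FiniteFlatGroupSchemes, (3.7)] -/
theorem forall_comp_i_comp_eq_one_iff_forall_comp_i_eq_one (𝔠 𝔭 𝔟 𝔞 : Ideal O) (hcop : 𝔟 ⊔ 𝔭 = ⊤) (h𝔠𝔞 : 𝔠 ⊔ 𝔟 = 𝔞 ⊔ 𝔟)
    (hker : ∀ ⦃T : Over S⦄ (z : T ⟶ A.X), z ≫ qbar = 1 → ∀ b ∈ 𝔭, z ≫ act.i b = 1)
    {T : Over S} (x : T ⟶ A.X) (hx : ∀ b ∈ 𝔟, x ≫ act.i b = 1) :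
    (∀ a ∈ 𝔠, x ≫ act.i a ≫ qbar = 1) ↔ ∀ a ∈ 𝔞, x ≫ act.i a = 1 := by
  -- `ι(a) x` is `𝔟`-torsion for every `a`
  have hxa : ∀ a, ∀ b ∈ 𝔟, (x ≫ act.i a) ≫ act.i b = 1 := fun a b hb => by
    rw [Category.assoc, ← act.i_mul, mul_comm, act.i_mul, ← Category.assoc, hx b hb]
    haveI := act.isMonHom_i a
    exact MonObj.one_comp _
  constructor
  · intro h
    -- `x` is killed by `𝔠`: `ι(c) x ∈ Ker q̄ ∩ A[𝔟] = 1`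
    have h𝔠 : ∀ c ∈ 𝔠, x ≫ act.i c = 1 := fun c hc =>
      (act.forall_mem_top_iff (x ≫ act.i c)).1 (hcop ▸ (act.forall_mem_sup_iff (x ≫ act.i c)).2
        ⟨hxa c, hker _ (by rw [Category.assoc]; exact h c hc)⟩)
    have h𝔞𝔟 : ∀ a ∈ 𝔞 ⊔ 𝔟, x ≫ act.i a = 1 := by
      rw [← h𝔠𝔞]
      exact (act.forall_mem_sup_iff x).2 ⟨h𝔠, hx⟩
    exact fun a ha => h𝔞𝔟 a (Ideal.mem_sup_left ha)
  · intro h a ha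
    have h𝔠𝔟 : ∀ c ∈ 𝔠 ⊔ 𝔟, x ≫ act.i c = 1 := by
      rw [h𝔠𝔞]
      exact (act.forall_mem_sup_iff x).2 ⟨h, hx⟩
    rw [← Category.assoc, h𝔠𝔟 a (Ideal.mem_sup_left ha)]
    exact MonObj.one_comp _

omit [IsMonHom qbar] in
/-- **THE `c•w`-BLOCK FORM OF THE RIGHT-HAND SIDE.**  On a point `x` killed by an ideal `𝔟` with `𝔠 + 𝔟 = O` (the co-ideal is a unit on the block: (π1)), and `Ker q̄` stable under
`ι` (`Roof₀` (r4₀)): «`∀ a ∈ 𝔠, x ≫ ι(a) ≫ q̄ = 1`» ↔ «`x ≫ q̄ = 1`» (some `a ∈ 𝔠` has `a ≡ 1 (mod 𝔟)`, so `ι(a) x = x`). [cite: Liu2021, Prop. D.8 (3) p. 137]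
[cite: Neukirch1999, Ch. I §3 (3.6)] -/
theorem forall_comp_i_comp_eq_one_iff_comp_eq_one (𝔠 𝔟 : Ideal O) (hcop : 𝔠 ⊔ 𝔟 = ⊤)
    (hqι : ∀ (a : O) ⦃T : Over S⦄ (z : T ⟶ A.X), z ≫ qbar = 1 → z ≫ act.i a ≫ qbar = 1)
    {T : Over S} (x : T ⟶ A.X) (hx : ∀ b ∈ 𝔟, x ≫ act.i b = 1) :
    (∀ a ∈ 𝔠, x ≫ act.i a ≫ qbar = 1) ↔ x ≫ qbar = 1 := by
  obtain ⟨a, ha, b, hb, hab⟩ := Submodule.mem_sup.1 ((Ideal.eq_top_iff_one _).1 hcop)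
  have hfix : x ≫ act.i a = x := act.comp_i_eq_self_of_sub_one_mem x hx (by
    have : a - 1 = -b := by rw [← hab]; ring
    rw [this]; exact 𝔟.neg_mem hb)
  constructor
  · intro h
    have := h a ha
    rwa [← Category.assoc, hfix] at this
  · intro h c hc
    exact hqι c x h

variable {k : Type u} [Field k] (p : ℕ) [ExpChar k p] (r : ℕ) {A' : AbelianSchemeOver (Spec (.of k))} (act' : RingAction O A')
  {Y' : SchemeOver k} [GrpObj Y'] (qbar' : A'.X ⟶ Y') [IsMonHom qbar']

/-- **THE (S-FIXED) PER-BLOCK LAW OF A BANAL BLOCK FROM A `𝔟`-TORSION LAW.**  Given an ideal `𝔟` with `𝔟·e ⊆ (q)` (so `q`-torsion points fixed by `ι(e)` are `𝔟`-torsion, §1),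
`𝔟 + 𝔭 = O`, `Ker q̄ ⊆ A[𝔭]`, `𝔠 + 𝔟 = 𝔞 + 𝔟`, and a law «on `𝔟`-torsion points: `x ≫ F = 1 ↔ ι(𝔞) x = 1`» (the shape of ★ `FrobKernelBanal₀` ∕ ★ LA4-p04 §5 at `𝔟 = 𝔭_u^n`):
the per-block law of §3 at `e`.  [cite: Liu2021, Prop. D.8 (3) pp. 136–138] [cite: Tate1997FiniteFlatGroupSchemes, (3.7)] -/
theorem blockLaw_of_idealTorsionLaw {e : O} (𝔠 𝔭 𝔟 𝔞 : Ideal O)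
    (h𝔟e : ∀ b ∈ 𝔟, b * e ∈ Ideal.span {((p ^ r : ℕ) : O)}) (hcop : 𝔟 ⊔ 𝔭 = ⊤) (h𝔠𝔞 : 𝔠 ⊔ 𝔟 = 𝔞 ⊔ 𝔟)
    (hker : ∀ ⦃T : SchemeOver k⦄ (z : T ⟶ A'.X), z ≫ qbar' = 1 → ∀ b ∈ 𝔭, z ≫ act'.i b = 1)
    (hban : ∀ ⦃T : SchemeOver k⦄ (x : T ⟶ A'.X), (∀ b ∈ 𝔟, x ≫ act'.i b = 1) →
      (x ≫ relFrobeniusOver p r A'.X = (1 : T ⟶ (A'.baseChange (frobSpec k p r)).X) ↔ ∀ a ∈ 𝔞, x ≫ act'.i a = 1))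
    ⦃T : SchemeOver k⦄ (x : T ⟶ A'.X) (hxN : x ≫ A'.mulN (p ^ r) = 1) (hxe : x ≫ act'.i e = x) :
    x ≫ relFrobeniusOver p r A'.X = (1 : T ⟶ (A'.baseChange (frobSpec k p r)).X) ↔ ∀ a ∈ 𝔠, x ≫ act'.i a ≫ qbar' = 1 := by
  have hx : ∀ b ∈ 𝔟, x ≫ act'.i b = 1 := act'.forall_comp_i_eq_one_of_mul_mem_span x hxN hxe h𝔟e
  rw [hban x hx, forall_comp_i_comp_eq_one_iff_forall_comp_i_eq_one act' qbar' 𝔠 𝔭 𝔟 𝔞 hcop h𝔠𝔞 hker x hx]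

end Bridges

/-! ## §5 (ED. 2) The kernel reading is insensitive to a post-composite that is a monomorphism on the block -/

section Postcomposite

variable {S : Scheme.{u}} {A C : AbelianSchemeOver S} {O : Type*} [CommRing O] (act : RingAction O A) (actC : RingAction O C)
  (qbar : A.X ⟶ C.X) [IsMonHom qbar] {Z : Over S} [GrpObj Z] (dbar : C.X ⟶ Z) [IsMonHom dbar]

/-- **KERNEL READING OF `q̄` VERSUS `q̄ ≫ d̄` ON A BLOCK.**  Let `q̄ : A → C` be `𝒪`-EQUIVARIANT (`ι_A(a) ≫ q̄ = q̄ ≫ ι_C(a)`, `Roof₀` (r4₀)) and `d̄ : C → Z` a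
homomorphism whose kernel is `(a)`-TORSION on `T`-points (`z ≫ d̄ = 1 → z ≫ ι_C(a) = 1`; e.g. `d̄ ≫ c̄ = ι_C(a)` for the return hom of a Serre cover).  Then on every
`T`-point `x` of `A` killed by an ideal `𝔟` with `(a) + 𝔟 = 𝒪` (the block where `a` is a unit — in the P6 ROOF: `𝔟 = 𝔭_{c•w}^n`, `a ∈ 𝔭_w ∖ 𝔭_{c•w}`):
«`x ≫ q̄ = 1 ↔ x ≫ q̄ ≫ d̄ = 1`» — the `𝔟`-block kernel readings of `q̄` and of the composite `ψ̄ = q̄ ≫ d̄` COINCIDE (the point `q̄ x` is `𝔟`-torsion by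
equivariance and `(a)`-torsion when `d̄` kills it, hence trivial: ★ LA4-p04 §1 `forall_mem_sup_iff`∕`forall_mem_top_iff`).  The ROOF uses it to read the
`c•w`-dock kernel of the reduced leg `q̄ : A_x̄ → 𝒞_{x̄″}` off the reduced roof hom `ψ̄ : A_x̄ → A_{x̄″}`. [cite: Liu2021, Prop. D.8 (2)–(3) pp. 135–137]
[cite: Neukirch1999, Ch. I §3 (3.6)] -/
theorem comp_eq_one_iff_comp_comp_eq_one_of_torsion (hq : ∀ a : O, act.i a ≫ qbar = qbar ≫ actC.i a) {a : O}
    (hd : ∀ ⦃T : Over S⦄ (z : T ⟶ C.X), z ≫ dbar = 1 → z ≫ actC.i a = 1) (𝔟 : Ideal O) (hcop : Ideal.span {a} ⊔ 𝔟 = ⊤)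
    {T : Over S} (x : T ⟶ A.X) (hx : ∀ b ∈ 𝔟, x ≫ act.i b = 1) :
    x ≫ qbar = 1 ↔ x ≫ qbar ≫ dbar = 1 := by
  constructor
  · intro h
    rw [← Category.assoc, h]
    exact MonObj.one_comp _
  · intro h
    -- `q̄ x` is `𝔟`-torsion (equivariance) and `(a)`-torsion (`d̄` kills it), and `(a) + 𝔟 = 𝒪`
    have h𝔟 : ∀ b ∈ 𝔟, (x ≫ qbar) ≫ actC.i b = 1 := fun b hb => by
      rw [Category.assoc, ← hq b, ← Category.assoc, hx b hb]
      exact MonObj.one_comp _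
    have ha : ∀ b ∈ Ideal.span {a}, (x ≫ qbar) ≫ actC.i b = 1 :=
      (actC.forall_mem_span_singleton_iff (x ≫ qbar)).2 (hd _ (by rw [Category.assoc]; exact h))
    exact (actC.forall_mem_top_iff (x ≫ qbar)).1 (hcop ▸ (actC.forall_mem_sup_iff (x ≫ qbar)).2 ⟨ha, h𝔟⟩)

/-- The same, as an identity of KERNEL CLAUSES against any predicate `P` on `𝔟`-torsion points (the shape the dock reading is stated in: «`x ≫ q̄ = 1 ↔ P x`» ⇔
«`x ≫ q̄ ≫ d̄ = 1 ↔ P x`»). [cite: Liu2021, Prop. D.8 (2)–(3) pp. 135–137] -/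
theorem comp_eq_one_iff_iff_comp_comp_eq_one_iff_of_torsion (hq : ∀ a : O, act.i a ≫ qbar = qbar ≫ actC.i a) {a : O}
    (hd : ∀ ⦃T : Over S⦄ (z : T ⟶ C.X), z ≫ dbar = 1 → z ≫ actC.i a = 1) (𝔟 : Ideal O) (hcop : Ideal.span {a} ⊔ 𝔟 = ⊤)
    {T : Over S} (x : T ⟶ A.X) (hx : ∀ b ∈ 𝔟, x ≫ act.i b = 1) (P : Prop) :
    (x ≫ qbar = 1 ↔ P) ↔ (x ≫ qbar ≫ dbar = 1 ↔ P) := by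
  rw [comp_eq_one_iff_comp_comp_eq_one_of_torsion act actC qbar dbar hq hd 𝔟 hcop x hx]

end Postcomposite

end Literature.AlgebraicGeometry.AbelianSchemes.AbelianSchemeOver

end
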